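import Mathlib.Analysis.Fourier.FourierTransformDeriv
import Mathlib.Analysis.Fourier.Inversion
import Mathlib.Analysis.SpecialFunctions.JapaneseBracket
import Mathlib.Topology.Order.MonotoneConvergence
import HarnessLib

/-!
# The Dixmier–Malliavin kernel on `ℝ`, I: the infinite product `ψ̂ = ∏ₙ (1 + (2π cₙ ξ)²)⁻¹`,
# its Fourier side, and the approximate identity `Σ_{j<n} (−1)ʲ b_j ψ^{(2j)} → δ`

Topic `Literature/Analysis/Convolution`; namespace `Literature.Analysis.Convolution.DixmierMalliavin`.
First of the modules DISCHARGING the named fact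
`Literature.Analysis.Convolution.DixmierMalliavin_real` (`DixmierMalliavin.lean`: every test function on
`ℝ` is a finite sum of convolutions of test functions — J. Dixmier, P. Malliavin, Bull. Sci. Math. 102
(1978) Thm. 3.1 [DixmierMalliavin1978]), following D. Hegde, *Schwartz functions, Hadamard products, and
the Dixmier–Malliavin theorem*, arXiv:2103.05495 [Hegde2021], §3.1 (Lemma 10: "given bounds `B_n > 0`
there exist `0 < b_n < B_n` and `ψ` with `Σ_{j≤n} (−1)ʲ b_j ψ^{(2j)} → δ`", via
`ψ̂ = 1/∏ₙ(1 + ξ²/aₙ²)`).  RH-context: the fact is the one classical input of the OFF-PATH strong form of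
Connes–Consani 2021 Thm. 4.7 (`CC2021_thm_4_7_of_prop_2_2_iii_of_xi_complete_of_factorization`);
this file is pure classical analysis, bears on no statement about `ζ`, and nothing here bears on the
truth of RH.

## Contents (all proved; definitions have bodies; no named facts)

* `IsAdmissible c` — the class of scale sequences `cₙ > 0`, `c₀ ≤ 1`, `c_{n+1} ≤ cₙ/2` (`cₙ = 1/(2πaₙ)`;
  a quantitative `Σ 1/aₙ < ∞`); tail bounds `Σ_{n≥k} cₙ² ≤ (4/3) c_k²`.
* `esq c N j` = `e_j(c₀², …, c_{N−1}²)` by the Pascal recursion, the generating identity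
  `∏_{n<N}(1 + u cₙ²) = Σ_j esq c N j uʲ` (`prod_one_add_mul_sq`), the uniform bound
  `esq c N j ≤ (4/3)ʲ ∏_{i<j} c_i²` (`IsAdmissible.esq_le`), the limit coefficients
  `coeff c j = b_j = sup_N esq c N j` (`coeff_zero : b₀ = 1`, `coeff_le`), and the CHOICE OF SCALES
  `exists_isAdmissible_coeff_mul_le`: for every `M : ℕ → ℝ` an admissible `c` with `b_j M_j ≤ 1`
  (`j ≥ 1`) — both the head `c₀` and the tail are shrunk (the constant coefficient `b₀ = 1` is absorbed
  later by rescaling the kernel).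
* The multipliers: `qf a ξ = 1 + (2πaξ)²`, finite tail products `tailFin c k N`, their decreasing limits
  `tail c k ξ = r_k(ξ) = ∏_{n≥k} q_{cₙ}(ξ)⁻¹` (`0 < r_k ≤ 1`, `tail_succ' : r_{k+1} = q_{c_k} r_k`,
  measurability, all moments `|ξ|ᵐ r_k ∈ L¹`).
* The kernels `psi c k = ψ_k := 𝓕 r_k` (Mathlib's `𝓕` on `ℝ → ℂ`): smooth (`contDiff_psi`), with
  `ψ_k^{(n)} = 𝓕((−2πiξ)ⁿ r_k)` and `‖ψ_k^{(n)}‖_∞ ≤ (2π)ⁿ ‖ξⁿ r_k‖₁`, and the EXACT RECURSION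
  `psi_sub_psi_succ : ψ_k − ψ_{k+1} = c_k² ψ_k''` (Fourier side of the Green's-function identity
  `p_c'' = (p_c − δ)/c²` for the Laplace kernel `p_c = (2c)⁻¹e^{−|x|/c}`, `ψ_k = p_{c_k} ∗ ψ_{k+1}`).
* The generating identity `hasSum_coeff_mul_pow : Σ_j b_j (2πξ)^{2j} = 1/r₀(ξ)`, the truncations
  `sfin c n`, `0 ≤ s_n r₀ ≤ 1`, `s_n r₀ → 1`, the kernel identity
  `kernel_eq_fourier : Σ_{j<n} (−1)ʲ b_j ψ₀^{(2j)} = 𝓕(s_n r₀)`, and the APPROXIMATE IDENTITY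
  `tendsto_integral_fourier_sfin_mul : ∫ 𝓕(s_n r₀) σ → σ(0)` for every test function `σ`
  (self-adjointness of `𝓕` + dominated convergence + Fourier inversion at `0`; with the integrability of
  `𝓕σ` for test functions, `integrable_fourier_of_contDiff`).

## What is NOT here (next modules, same namespace)

The uniform annulus bounds `sup_{|x|≥1/2} |ψ₀^{(m)}| ≤ K_m` over the admissible class (contour shift
for `ψ_k`, even orders through the recursion, odd orders by interpolation) and the assembly of the
kernel package `(b, f = λωψ₀, h)` with `Σ_{j<n}(−1)ʲ b_j f^{(2j)} → δ + h` — the hypothesis `H` of the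
abstract factorization step (seat cc-t4's module) — hence `DixmierMalliavin_real_holds`.
NOTE on the source: [Hegde2021, Claim 13] ("uniform bounds on `sup_ℝ |ψ^{(j)}|` given `aₙ ≥ n`")
cannot hold on all of `ℝ` (as the scales shrink `ψ` tends to a Laplace kernel, not `C¹` at `0`); only
the annulus version is true and is what the proof needs (recorded on the cell board, errata candidate).

## References
* J. Dixmier, P. Malliavin, *Factorisations de fonctions et de vecteurs indéfiniment différentiables*,
  Bull. Sci. Math. (2) 102 (1978) 305–330, Thm. 3.1. [DixmierMalliavin1978]
* D. Hegde, *Schwartz functions, Hadamard products, and the Dixmier–Malliavin theorem*,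
  arXiv:2103.05495 (2021), §3.1 Lemma 10, §3.2. [Hegde2021]
-/

noncomputable section

open MeasureTheory Filter Complex Set Finset
open scoped Topology Real BigOperators FourierTransform ContDiff

namespace Literature.Analysis.Convolution

namespace DixmierMalliavin

/-! ## Admissible scale sequences -/

/-- An *admissible* sequence of scales for the Dixmier–Malliavin kernel: positive, `c 0 ≤ 1`, and at
least halving at each step (`c (n+1) ≤ c n / 2`).  The kernel is `ψ̂(ξ) = ∏ₙ (1 + (2π cₙ ξ)²)⁻¹`
(`cₙ = 1/(2π aₙ)` in the notation of [Hegde2021, §3.1]); the halving condition is a convenient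
quantitative form of `Σ 1/aₙ < ∞`. [cite: Hegde2021, §3.1 Cor. 9–Lemma 10 (pp. 6–7)] -/
structure IsAdmissible (c : ℕ → ℝ) : Prop where
  pos : ∀ n, 0 < c n
  head_le_one : c 0 ≤ 1
  succ_le : ∀ n, c (n + 1) ≤ c n / 2

namespace IsAdmissible

variable {c : ℕ → ℝ} (hc : IsAdmissible c)
include hc

/-- `c (k + m) ≤ c k / 2 ^ m`. [cite: Hegde2021, §3.1 Lemma 10 (p. 6)] -/
theorem add_le (k m : ℕ) : c (k + m) ≤ c k / 2 ^ m := by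
  induction m with
  | zero => simp
  | succ m ih =>
    calc c (k + (m + 1)) = c (k + m + 1) := by rw [Nat.add_assoc]
      _ ≤ c (k + m) / 2 := hc.succ_le _
      _ ≤ c k / 2 ^ m / 2 := by gcongr
      _ = c k / 2 ^ (m + 1) := by rw [pow_succ, div_div]

/-- The scales decrease. [cite: Hegde2021, §3.1 Lemma 10 (p. 6)] -/
theorem antitone : Antitone c := by
  refine antitone_nat_of_succ_le fun n => ?_
  have := hc.succ_le n
  have := hc.pos n
  linarith

/-- All scales are `≤ 1`. [cite: Hegde2021, §3.1 Lemma 10 (p. 6)] -/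
theorem le_one (n : ℕ) : c n ≤ 1 := (hc.antitone (Nat.zero_le n)).trans hc.head_le_one

/-- `c (k + m)² ≤ c k² / 4 ^ m`. [cite: Hegde2021, §3.1 Lemma 10 (p. 6)] -/
theorem sq_add_le (k m : ℕ) : c (k + m) ^ 2 ≤ c k ^ 2 / 4 ^ m := by
  have h := hc.add_le k m
  have h0 : 0 ≤ c (k + m) := (hc.pos _).le
  calc c (k + m) ^ 2 ≤ (c k / 2 ^ m) ^ 2 := pow_le_pow_left₀ h0 h 2
    _ = c k ^ 2 / 4 ^ m := by
      rw [div_pow, ← pow_mul, show (2 : ℝ) ^ (m * 2) = 4 ^ m by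
        rw [mul_comm, pow_mul]; norm_num]

/-- The tail sums of squares: `Σ_{m} c (k+m)² ≤ (4/3) c k²` (summable, geometric comparison).
[cite: Hegde2021, §3.1 Lemma 10 (p. 6)] -/
theorem summable_sq_add (k : ℕ) : Summable fun m : ℕ => c (k + m) ^ 2 := by
  refine Summable.of_nonneg_of_le (fun m => sq_nonneg _) (fun m => hc.sq_add_le k m) ?_
  have : Summable fun m : ℕ => c k ^ 2 * (1 / 4) ^ m :=
    (summable_geometric_of_lt_one (by norm_num) (by norm_num)).mul_left _
  refine this.congr fun m => ?_
  rw [one_div, inv_pow, div_eq_mul_inv]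

/-- `Σ_{m} c (k+m)² ≤ (4/3) c k²`. [cite: Hegde2021, §3.1 Lemma 10 (p. 6)] -/
theorem tsum_sq_add_le (k : ℕ) : ∑' m : ℕ, c (k + m) ^ 2 ≤ 4 / 3 * c k ^ 2 := by
  have hgeo : HasSum (fun m : ℕ => c k ^ 2 * (1 / 4 : ℝ) ^ m) (c k ^ 2 * (1 - 1 / 4)⁻¹) :=
    (hasSum_geometric_of_lt_one (by norm_num) (by norm_num)).mul_left _
  have hle : ∑' m : ℕ, c (k + m) ^ 2 ≤ ∑' m : ℕ, c k ^ 2 * (1 / 4 : ℝ) ^ m :=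
    (hc.summable_sq_add k).tsum_le_tsum (fun m => by
      rw [one_div, inv_pow, ← div_eq_mul_inv]; exact hc.sq_add_le k m) hgeo.summable
  rw [hgeo.tsum_eq] at hle
  norm_num at hle
  linarith

/-- Finite tail sums of squares: `Σ_{n ∈ [k, N)} c n² ≤ (4/3) c k²`. [cite: Hegde2021, §3.1 Lemma 10 (p. 6)] -/
theorem sum_sq_Ico_le (k N : ℕ) : ∑ n ∈ Finset.Ico k N, c n ^ 2 ≤ 4 / 3 * c k ^ 2 := by
  rcases le_or_gt N k with h | h
  · rw [Finset.Ico_eq_empty_of_le h, Finset.sum_empty]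
    positivity
  · rw [Finset.sum_Ico_eq_sum_range]
    exact (Summable.sum_le_tsum _ (fun m _ => sq_nonneg _) (hc.summable_sq_add k)).trans
      (hc.tsum_sq_add_le k)

end IsAdmissible

/-! ## The coefficients `b_j = e_j(c₀², c₁², …)` -/

/-- The elementary symmetric functions of `c₀², …, c_{N−1}²`, defined by the Pascal recursion
`e_{j+1}(x₀..x_N) = e_{j+1}(x₀..x_{N−1}) + x_N e_j(x₀..x_{N−1})`: the coefficients of the partial
products `∏_{n<N} (1 + u cₙ²) = Σ_j esq c N j uʲ`. [cite: Hegde2021, §3.1 Lemma 10 (p. 6)] -/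
def esq (c : ℕ → ℝ) : ℕ → ℕ → ℝ
  | 0, 0 => 1
  | 0, _ + 1 => 0
  | _ + 1, 0 => 1
  | N + 1, j + 1 => esq c N (j + 1) + c N ^ 2 * esq c N j

/-- `esq c N 0 = 1`. [cite: Hegde2021, §3.1 Lemma 10 (p. 6)] -/
@[simp] theorem esq_zero_right (c : ℕ → ℝ) (N : ℕ) : esq c N 0 = 1 := by
  cases N <;> simp [esq]

/-- `esq c 0 (j+1) = 0`. [cite: Hegde2021, §3.1 Lemma 10 (p. 6)] -/
@[simp] theorem esq_zero_succ (c : ℕ → ℝ) (j : ℕ) : esq c 0 (j + 1) = 0 := by simp [esq]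

/-- The Pascal recursion. [cite: Hegde2021, §3.1 Lemma 10 (p. 6)] -/
theorem esq_succ_succ (c : ℕ → ℝ) (N j : ℕ) :
    esq c (N + 1) (j + 1) = esq c N (j + 1) + c N ^ 2 * esq c N j := by simp [esq]

/-- Nonnegativity. [cite: Hegde2021, §3.1 Lemma 10 (p. 6)] -/
theorem esq_nonneg (c : ℕ → ℝ) (N j : ℕ) : 0 ≤ esq c N j := by
  induction N generalizing j with
  | zero => cases j <;> simp
  | succ N ih =>
    cases j with
    | zero => simp
    | succ j => rw [esq_succ_succ]; exact add_nonneg (ih _) (mul_nonneg (sq_nonneg _) (ih _))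

/-- `esq c N j = 0` for `N < j` (no `j`-subsets). [cite: Hegde2021, §3.1 Lemma 10 (p. 6)] -/
theorem esq_eq_zero_of_lt (c : ℕ → ℝ) {N j : ℕ} (h : N < j) : esq c N j = 0 := by
  induction N generalizing j with
  | zero => cases j with
    | zero => omega
    | succ j => simp
  | succ N ih =>
    cases j with
    | zero => omega
    | succ j => rw [esq_succ_succ, ih (by omega), ih (by omega)]; ring

/-- Monotonicity in `N`. [cite: Hegde2021, §3.1 Lemma 10 (p. 6)] -/
theorem esq_le_succ (c : ℕ → ℝ) (N j : ℕ) : esq c N j ≤ esq c (N + 1) j := by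
  cases j with
  | zero => simp
  | succ j =>
    rw [esq_succ_succ]
    have := esq_nonneg c N j
    nlinarith [sq_nonneg (c N)]

/-- Monotonicity in `N`. [cite: Hegde2021, §3.1 Lemma 10 (p. 6)] -/
theorem esq_mono (c : ℕ → ℝ) (j : ℕ) : Monotone fun N => esq c N j :=
  monotone_nat_of_le_succ fun N => esq_le_succ c N j

/-- The telescoped recursion: `esq c N (j+1) = Σ_{n<N} cₙ² · esq c n j`. [cite: Hegde2021, §3.1 Lemma 10 (p. 6)] -/
theorem esq_succ_eq_sum (c : ℕ → ℝ) (N j : ℕ) :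
    esq c N (j + 1) = ∑ n ∈ Finset.range N, c n ^ 2 * esq c n j := by
  induction N with
  | zero => simp
  | succ N ih => rw [esq_succ_succ, Finset.sum_range_succ, ih]

/-- The generating identity: `∏_{n<N} (1 + u·cₙ²) = Σ_{j ≤ N} esq c N j · uʲ`.
[cite: Hegde2021, §3.1 Lemma 10 (p. 6)] -/
theorem prod_one_add_mul_sq (c : ℕ → ℝ) (u : ℝ) (N : ℕ) :
    ∏ n ∈ Finset.range N, (1 + u * c n ^ 2) = ∑ j ∈ Finset.range (N + 1), esq c N j * u ^ j := by
  induction N with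
  | zero => simp
  | succ N ih =>
    rw [Finset.prod_range_succ, ih, Finset.sum_range_succ' (f := fun j => esq c (N + 1) j * u ^ j)]
    simp only [esq_succ_succ, esq_zero_right, pow_zero, mul_one]
    rw [Finset.sum_range_succ' (f := fun j => esq c N j * u ^ j)]
    simp only [esq_zero_right, pow_zero, mul_one]
    have h1 : ∑ j ∈ Finset.range N, (esq c N (j + 1) + c N ^ 2 * esq c N j) * u ^ (j + 1) =
        ∑ j ∈ Finset.range N, esq c N (j + 1) * u ^ (j + 1) +
          u * c N ^ 2 * ∑ j ∈ Finset.range N, esq c N j * u ^ j := by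
      rw [Finset.mul_sum, ← Finset.sum_add_distrib]
      refine Finset.sum_congr rfl fun j _ => ?_
      ring
    rw [Finset.sum_range_succ (fun j => (esq c N (j + 1) + c N ^ 2 * esq c N j) * u ^ (j + 1)), h1,
      esq_eq_zero_of_lt c (Nat.lt_succ_self N), zero_add]
    have h2 : ∑ j ∈ Finset.range N, esq c N j * u ^ j =
        ∑ j ∈ Finset.range (N + 1), esq c N j * u ^ j - esq c N N * u ^ N := by
      rw [Finset.sum_range_succ]; ring
    rw [h2]
    rw [Finset.sum_range_succ' (f := fun j => esq c N j * u ^ j)]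
    simp only [esq_zero_right, pow_zero, mul_one]
    ring

/-! ### Bounds on the coefficients under admissibility and the limit coefficients `b_j` -/

section Coeff

variable {c : ℕ → ℝ}

/-- Under admissibility, `e_j(c₀², …, c_{N−1}²) ≤ (4/3)ʲ ∏_{i<j} c_i²`, uniformly in `N` (induction
on `j` through the telescoped recursion and the tail bound `Σ_{n≥j} cₙ² ≤ (4/3) c_j²`).
[cite: Hegde2021, §3.1 Lemma 10 (p. 6)] -/
theorem IsAdmissible.esq_le (hc : IsAdmissible c) (N j : ℕ) :
    esq c N j ≤ (4 / 3) ^ j * ∏ i ∈ Finset.range j, c i ^ 2 := by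
  induction j generalizing N with
  | zero => simp
  | succ j ih =>
    rw [esq_succ_eq_sum]
    set B : ℝ := (4 / 3) ^ j * ∏ i ∈ Finset.range j, c i ^ 2 with hB
    have hB0 : 0 ≤ B := by positivity
    have hterm : ∀ n, c n ^ 2 * esq c n j ≤ if j ≤ n then c n ^ 2 * B else 0 := by
      intro n
      split_ifs with h
      · exact mul_le_mul_of_nonneg_left (ih n) (sq_nonneg _)
      · rw [esq_eq_zero_of_lt c (lt_of_not_ge h), mul_zero]
    calc ∑ n ∈ Finset.range N, c n ^ 2 * esq c n j
        ≤ ∑ n ∈ Finset.range N, (if j ≤ n then c n ^ 2 * B else 0) :=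
          Finset.sum_le_sum fun n _ => hterm n
      _ = B * ∑ n ∈ (Finset.range N).filter (fun n => j ≤ n), c n ^ 2 := by
        rw [Finset.sum_filter, Finset.mul_sum]
        refine Finset.sum_congr rfl fun n _ => ?_
        split_ifs <;> ring
      _ ≤ B * (4 / 3 * c j ^ 2) := by
        refine mul_le_mul_of_nonneg_left ?_ hB0
        have hsub : (Finset.range N).filter (fun n => j ≤ n) = Finset.Ico j N := by
          ext n; simp [Finset.mem_Ico, and_comm]
        rw [hsub]
        exact hc.sum_sq_Ico_le j N
      _ = (4 / 3) ^ (j + 1) * ∏ i ∈ Finset.range (j + 1), c i ^ 2 := by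
        rw [hB, Finset.prod_range_succ, pow_succ]; ring

/-- The range of `N ↦ esq c N j` is bounded above (by `esq_le`). [cite: Hegde2021, §3.1 Lemma 10 (p. 6)] -/
theorem IsAdmissible.bddAbove_esq (hc : IsAdmissible c) (j : ℕ) :
    BddAbove (Set.range fun N => esq c N j) :=
  ⟨_, by rintro _ ⟨N, rfl⟩; exact hc.esq_le N j⟩

/-- The coefficients `b_j := e_j(c₀², c₁², …) = sup_N e_j(c₀², …, c_{N−1}²)` of the entire function
`P(ξ) = ∏ₙ (1 + (2π cₙ ξ)²) = Σ_j b_j (2πξ)^{2j}` — the coefficients of the infinite-order constant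
coefficient operator `Σ_j (−1)ʲ b_j ∂^{2j}` of [Hegde2021, Lemma 10].
[cite: Hegde2021, §3.1 Lemma 10 (p. 6)] -/
def coeff (c : ℕ → ℝ) (j : ℕ) : ℝ := ⨆ N : ℕ, esq c N j

/-- `e_j^{(N)} ≤ b_j`. [cite: Hegde2021, §3.1 Lemma 10 (p. 6)] -/
theorem IsAdmissible.esq_le_coeff (hc : IsAdmissible c) (N j : ℕ) : esq c N j ≤ coeff c j :=
  le_ciSup (hc.bddAbove_esq j) N

/-- `e_j^{(N)} → b_j`. [cite: Hegde2021, §3.1 Lemma 10 (p. 6)] -/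
theorem IsAdmissible.tendsto_esq (hc : IsAdmissible c) (j : ℕ) :
    Tendsto (fun N => esq c N j) atTop (𝓝 (coeff c j)) :=
  tendsto_atTop_ciSup (esq_mono c j) (hc.bddAbove_esq j)

/-- `b_j ≤ (4/3)ʲ ∏_{i<j} c_i²` — so the coefficients are driven to `0` as fast as desired by choosing
the scales small. [cite: Hegde2021, §3.1 Lemma 10 (p. 6)] -/
theorem IsAdmissible.coeff_le (hc : IsAdmissible c) (j : ℕ) :
    coeff c j ≤ (4 / 3) ^ j * ∏ i ∈ Finset.range j, c i ^ 2 :=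
  ciSup_le fun N => hc.esq_le N j

/-- `0 ≤ b_j`. [cite: Hegde2021, §3.1 Lemma 10 (p. 6)] -/
theorem IsAdmissible.coeff_nonneg (hc : IsAdmissible c) (j : ℕ) : 0 ≤ coeff c j :=
  (esq_nonneg c 0 j).trans (hc.esq_le_coeff 0 j)

/-- `b₀ = 1`. [cite: Hegde2021, §3.1 Lemma 10 (p. 6)] -/
theorem coeff_zero (c : ℕ → ℝ) : coeff c 0 = 1 := by
  simp [coeff]

end Coeff

/-! ### Choosing the scales against a prescribed growth -/

section Choice

/-- The recursive construction of the scales against a prescribed sequence `M`: the pair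
`(c_j, ∏_{i≤j} c_i²)`, with `c₀ = min 1 √(3/(4M₁'))` and
`c_{j+1} = min (c_j/2) √((3/4)^{j+2}/(M'_{j+2} ∏_{i≤j} c_i²))`, `M' = max M 1`.
[cite: Hegde2021, §3.1 Lemma 10 (p. 6)] -/
def scaleAux (M : ℕ → ℝ) : ℕ → ℝ × ℝ
  | 0 => (min 1 (Real.sqrt (3 / (4 * max (M 1) 1))), (min 1 (Real.sqrt (3 / (4 * max (M 1) 1)))) ^ 2)
  | j + 1 =>
    (min ((scaleAux M j).1 / 2)
        (Real.sqrt ((3 / 4) ^ (j + 2) / (max (M (j + 2)) 1 * (scaleAux M j).2))),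
      (scaleAux M j).2 *
        (min ((scaleAux M j).1 / 2)
          (Real.sqrt ((3 / 4) ^ (j + 2) / (max (M (j + 2)) 1 * (scaleAux M j).2)))) ^ 2)

/-- The scales chosen against `M`. [cite: Hegde2021, §3.1 Lemma 10 (p. 6)] -/
def scale (M : ℕ → ℝ) (j : ℕ) : ℝ := (scaleAux M j).1

/-- Unfolding the recursion (first component). [cite: Hegde2021, §3.1 Lemma 10 (p. 6)] -/
theorem scaleAux_succ_fst (M : ℕ → ℝ) (j : ℕ) :
    (scaleAux M (j + 1)).1 = min ((scaleAux M j).1 / 2)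
      (Real.sqrt ((3 / 4) ^ (j + 2) / (max (M (j + 2)) 1 * (scaleAux M j).2))) := rfl

/-- Unfolding the recursion (second component). [cite: Hegde2021, §3.1 Lemma 10 (p. 6)] -/
theorem scaleAux_succ_snd (M : ℕ → ℝ) (j : ℕ) :
    (scaleAux M (j + 1)).2 = (scaleAux M j).2 * (scaleAux M (j + 1)).1 ^ 2 := rfl

/-- The second component is the running product of squares. [cite: Hegde2021, §3.1 Lemma 10 (p. 6)] -/
theorem scaleAux_snd (M : ℕ → ℝ) (j : ℕ) :
    (scaleAux M j).2 = ∏ i ∈ Finset.range (j + 1), scale M i ^ 2 := by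
  induction j with
  | zero => simp [scaleAux, scale]
  | succ j ih => rw [Finset.prod_range_succ, ← ih, scaleAux_succ_snd]; rfl

/-- Positivity of the construction. [cite: Hegde2021, §3.1 Lemma 10 (p. 6)] -/
theorem scaleAux_pos (M : ℕ → ℝ) (j : ℕ) : 0 < (scaleAux M j).1 ∧ 0 < (scaleAux M j).2 := by
  induction j with
  | zero =>
    have h : 0 < min 1 (Real.sqrt (3 / (4 * max (M 1) 1))) :=
      lt_min one_pos (Real.sqrt_pos.mpr (by positivity))
    exact ⟨h, pow_pos h 2⟩
  | succ j ih =>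
    have h1 : 0 < (scaleAux M (j + 1)).1 := by
      rw [scaleAux_succ_fst]
      refine lt_min (by linarith [ih.1]) (Real.sqrt_pos.mpr ?_)
      have := ih.2
      positivity
    exact ⟨h1, by rw [scaleAux_succ_snd]; exact mul_pos ih.2 (pow_pos h1 2)⟩

/-- The chosen scales are admissible. [cite: Hegde2021, §3.1 Lemma 10 (p. 6)] -/
theorem isAdmissible_scale (M : ℕ → ℝ) : IsAdmissible (scale M) where
  pos j := (scaleAux_pos M j).1
  head_le_one := min_le_left _ _
  succ_le j := by
    show (scaleAux M (j + 1)).1 ≤ (scaleAux M j).1 / 2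
    rw [scaleAux_succ_fst]
    exact min_le_left _ _

/-- The running products obey `∏_{i≤j} c_i² ≤ (3/4)^{j+1} / M'_{j+1}`. [cite: Hegde2021, §3.1 Lemma 10 (p. 6)] -/
theorem prod_scale_sq_le (M : ℕ → ℝ) (j : ℕ) :
    ∏ i ∈ Finset.range (j + 1), scale M i ^ 2 ≤ (3 / 4) ^ (j + 1) / max (M (j + 1)) 1 := by
  rw [← scaleAux_snd]
  cases j with
  | zero =>
    show (min 1 (Real.sqrt (3 / (4 * max (M 1) 1)))) ^ 2 ≤ _
    have hM : 0 < max (M 1) 1 := lt_max_of_lt_right one_pos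
    calc (min 1 (Real.sqrt (3 / (4 * max (M 1) 1)))) ^ 2
        ≤ (Real.sqrt (3 / (4 * max (M 1) 1))) ^ 2 :=
          pow_le_pow_left₀ (le_min zero_le_one (Real.sqrt_nonneg _)) (min_le_right _ _) 2
      _ = 3 / (4 * max (M 1) 1) := Real.sq_sqrt (by positivity)
      _ = (3 / 4) ^ (0 + 1) / max (M (0 + 1)) 1 := by ring
  | succ j =>
    rw [scaleAux_succ_snd]
    have hp := (scaleAux_pos M j).2
    have hM : 0 < max (M (j + 2)) 1 := lt_max_of_lt_right one_pos
    have hc1 : (scaleAux M (j + 1)).1 ^ 2 ≤ (3 / 4) ^ (j + 2) / (max (M (j + 2)) 1 * (scaleAux M j).2) := by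
      rw [scaleAux_succ_fst]
      calc _ ≤ (Real.sqrt ((3 / 4) ^ (j + 2) / (max (M (j + 2)) 1 * (scaleAux M j).2))) ^ 2 :=
            pow_le_pow_left₀ (le_min (by linarith [(scaleAux_pos M j).1]) (Real.sqrt_nonneg _))
              (min_le_right _ _) 2
        _ = _ := Real.sq_sqrt (by positivity)
    calc (scaleAux M j).2 * (scaleAux M (j + 1)).1 ^ 2
        ≤ (scaleAux M j).2 * ((3 / 4) ^ (j + 2) / (max (M (j + 2)) 1 * (scaleAux M j).2)) :=
          mul_le_mul_of_nonneg_left hc1 hp.le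
      _ = (3 / 4) ^ (j + 1 + 1) / max (M (j + 1 + 1)) 1 := by
        field_simp

/-- **Choice of scales.** For every sequence `M` there is an admissible sequence of scales whose
coefficients satisfy `b_j · M_j ≤ 1` for all `j ≥ 1` (the constant coefficient `b₀ = 1` is rescaled
into the kernel separately). [cite: Hegde2021, §3.1 Lemma 10 (p. 6)] -/
theorem exists_isAdmissible_coeff_mul_le (M : ℕ → ℝ) :
    ∃ c : ℕ → ℝ, IsAdmissible c ∧ ∀ j, 1 ≤ j → coeff c j * M j ≤ 1 := by
  refine ⟨scale M, isAdmissible_scale M, fun j hj => ?_⟩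
  obtain ⟨j, rfl⟩ : ∃ i, j = i + 1 := ⟨j - 1, by omega⟩
  have hM : 0 < max (M (j + 1)) 1 := lt_max_of_lt_right one_pos
  have h1 := (isAdmissible_scale M).coeff_le (j + 1)
  have h2 := prod_scale_sq_le M j
  have h3 : coeff (scale M) (j + 1) ≤ 1 / max (M (j + 1)) 1 := by
    calc coeff (scale M) (j + 1) ≤ (4 / 3) ^ (j + 1) * ∏ i ∈ Finset.range (j + 1), scale M i ^ 2 := h1
      _ ≤ (4 / 3) ^ (j + 1) * ((3 / 4) ^ (j + 1) / max (M (j + 1)) 1) :=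
          mul_le_mul_of_nonneg_left h2 (by positivity)
      _ = 1 / max (M (j + 1)) 1 := by
          rw [← mul_div_assoc, ← mul_pow]; norm_num
  have h0 : 0 ≤ coeff (scale M) (j + 1) := (isAdmissible_scale M).coeff_nonneg _
  calc coeff (scale M) (j + 1) * M (j + 1) ≤ coeff (scale M) (j + 1) * max (M (j + 1)) 1 :=
        mul_le_mul_of_nonneg_left (le_max_left _ _) h0
    _ ≤ 1 / max (M (j + 1)) 1 * max (M (j + 1)) 1 := mul_le_mul_of_nonneg_right h3 hM.le
    _ = 1 := by field_simp

end Choice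

/-! ## The Fourier multipliers `r_k(ξ) = ∏_{n ≥ k} (1 + (2π cₙ ξ)²)⁻¹` -/

section Multiplier

variable {c : ℕ → ℝ}

/-- The single factor `q_a(ξ) = 1 + (2π a ξ)²` (the Fourier transform of the Laplace kernel
`(2a)⁻¹ e^{−|x|/a}` is `1/q_a`). [cite: Hegde2021, §3.1 Lemma 10 (p. 6)] -/
def qf (a ξ : ℝ) : ℝ := 1 + (2 * π * a * ξ) ^ 2

/-- `1 ≤ q_a(ξ)`. [cite: Hegde2021, §3.1 Lemma 10 (p. 6)] -/
theorem one_le_qf (a ξ : ℝ) : 1 ≤ qf a ξ := by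
  unfold qf; nlinarith [sq_nonneg (2 * π * a * ξ)]

/-- `0 < q_a(ξ)`. [cite: Hegde2021, §3.1 Lemma 10 (p. 6)] -/
theorem qf_pos (a ξ : ℝ) : 0 < qf a ξ := lt_of_lt_of_le one_pos (one_le_qf a ξ)

/-- Monotonicity of `q_a(ξ)` in `a ≥ 0`. [cite: Hegde2021, §3.1 Lemma 10 (p. 6)] -/
theorem qf_le_qf {a b : ℝ} (ha : 0 ≤ a) (hab : a ≤ b) (ξ : ℝ) : qf a ξ ≤ qf b ξ := by
  unfold qf
  have : (2 * π * a * ξ) ^ 2 ≤ (2 * π * b * ξ) ^ 2 := by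
    rw [show (2 * π * a * ξ) ^ 2 = (2 * π * ξ) ^ 2 * a ^ 2 by ring,
      show (2 * π * b * ξ) ^ 2 = (2 * π * ξ) ^ 2 * b ^ 2 by ring]
    exact mul_le_mul_of_nonneg_left (pow_le_pow_left₀ ha hab 2) (sq_nonneg _)
  linarith

/-- Continuity of `q_a`. [cite: Hegde2021, §3.1 Lemma 10 (p. 6)] -/
theorem continuous_qf (a : ℝ) : Continuous (qf a) := by
  unfold qf; fun_prop

/-- The finite tail products `r_{k,N}(ξ) = ∏_{n ∈ [k,N)} q_{cₙ}(ξ)⁻¹`. [cite: Hegde2021, §3.1 Lemma 10 (p. 6)] -/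
def tailFin (c : ℕ → ℝ) (k N : ℕ) (ξ : ℝ) : ℝ := ∏ n ∈ Finset.Ico k N, (qf (c n) ξ)⁻¹

/-- `0 < r_{k,N}`. [cite: Hegde2021, §3.1 Lemma 10 (p. 6)] -/
theorem tailFin_pos (c : ℕ → ℝ) (k N : ℕ) (ξ : ℝ) : 0 < tailFin c k N ξ :=
  Finset.prod_pos fun _ _ => inv_pos.mpr (qf_pos _ _)

/-- `r_{k,N} ≤ 1`. [cite: Hegde2021, §3.1 Lemma 10 (p. 6)] -/
theorem tailFin_le_one (c : ℕ → ℝ) (k N : ℕ) (ξ : ℝ) : tailFin c k N ξ ≤ 1 :=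
  Finset.prod_le_one (fun _ _ => (inv_pos.mpr (qf_pos _ _)).le)
    fun _ _ => inv_le_one_of_one_le₀ (one_le_qf _ _)

/-- `N ↦ r_{k,N}(ξ)` is antitone. [cite: Hegde2021, §3.1 Lemma 10 (p. 6)] -/
theorem tailFin_antitone (c : ℕ → ℝ) (k : ℕ) (ξ : ℝ) : Antitone fun N => tailFin c k N ξ := by
  refine antitone_nat_of_succ_le fun N => ?_
  rcases lt_or_ge N k with h | h
  · simp [tailFin, Finset.Ico_eq_empty_of_le h.le, Finset.Ico_eq_empty_of_le (Nat.succ_le_of_lt h)]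
  · simp only [tailFin]
    rw [Finset.prod_Ico_succ_top h]
    exact mul_le_of_le_one_right (tailFin_pos c k N ξ).le (inv_le_one_of_one_le₀ (one_le_qf _ _))

/-- Peeling off the first factor: `r_{k,N} = q_{c_k}⁻¹ · r_{k+1,N}` for `k < N`. [cite: Hegde2021, §3.1 Lemma 10 (p. 6)] -/
theorem tailFin_succ (c : ℕ → ℝ) {k N : ℕ} (h : k < N) (ξ : ℝ) :
    tailFin c k N ξ = (qf (c k) ξ)⁻¹ * tailFin c (k + 1) N ξ := by
  simp only [tailFin]
  rw [Finset.prod_eq_prod_Ico_succ_bot h]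

/-- Continuity of the finite products. [cite: Hegde2021, §3.1 Lemma 10 (p. 6)] -/
theorem continuous_tailFin (c : ℕ → ℝ) (k N : ℕ) : Continuous (tailFin c k N) := by
  unfold tailFin
  exact continuous_finsetProd _ fun n _ => (continuous_qf (c n)).inv₀ fun ξ => (qf_pos _ _).ne'

/-- The infinite tail product `r_k(ξ) = ∏_{n ≥ k} q_{cₙ}(ξ)⁻¹ = inf_N r_{k,N}(ξ)` (a decreasing limit).
[cite: Hegde2021, §3.1 Lemma 10 (p. 6)] -/
def tail (c : ℕ → ℝ) (k : ℕ) (ξ : ℝ) : ℝ := ⨅ N : ℕ, tailFin c k N ξ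

/-- Boundedness below of the finite products. [cite: Hegde2021, §3.1 Lemma 10 (p. 6)] -/
theorem bddBelow_tailFin (c : ℕ → ℝ) (k : ℕ) (ξ : ℝ) : BddBelow (Set.range fun N => tailFin c k N ξ) :=
  ⟨0, by rintro _ ⟨N, rfl⟩; exact (tailFin_pos c k N ξ).le⟩

/-- `r_{k,N}(ξ) → r_k(ξ)`. [cite: Hegde2021, §3.1 Lemma 10 (p. 6)] -/
theorem tendsto_tailFin (c : ℕ → ℝ) (k : ℕ) (ξ : ℝ) :
    Tendsto (fun N => tailFin c k N ξ) atTop (𝓝 (tail c k ξ)) :=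
  tendsto_atTop_ciInf (tailFin_antitone c k ξ) (bddBelow_tailFin c k ξ)

/-- `r_k ≤ r_{k,N}`. [cite: Hegde2021, §3.1 Lemma 10 (p. 6)] -/
theorem tail_le_tailFin (c : ℕ → ℝ) (k N : ℕ) (ξ : ℝ) : tail c k ξ ≤ tailFin c k N ξ :=
  ciInf_le (bddBelow_tailFin c k ξ) N

/-- `r_k ≤ 1`. [cite: Hegde2021, §3.1 Lemma 10 (p. 6)] -/
theorem tail_le_one (c : ℕ → ℝ) (k : ℕ) (ξ : ℝ) : tail c k ξ ≤ 1 :=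
  (tail_le_tailFin c k 0 ξ).trans (tailFin_le_one c k 0 ξ)

/-- `0 ≤ r_k`. [cite: Hegde2021, §3.1 Lemma 10 (p. 6)] -/
theorem tail_nonneg (c : ℕ → ℝ) (k : ℕ) (ξ : ℝ) : 0 ≤ tail c k ξ :=
  le_ciInf fun N => (tailFin_pos c k N ξ).le

/-- Lower bound for the finite products: `exp(−(4/3)(2πξ)² c_k²) ≤ r_{k,N}(ξ)` (from `1 + t ≤ eᵗ` and
the tail bound on `Σ cₙ²`). [cite: Hegde2021, §3.1 Lemma 10 (p. 6)] -/
theorem IsAdmissible.exp_le_tailFin (hc : IsAdmissible c) (k N : ℕ) (ξ : ℝ) :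
    Real.exp (-(4 / 3 * (2 * π * ξ) ^ 2 * c k ^ 2)) ≤ tailFin c k N ξ := by
  have hfac : ∀ n, Real.exp (-((2 * π * ξ) ^ 2 * c n ^ 2)) ≤ (qf (c n) ξ)⁻¹ := by
    intro n
    rw [Real.exp_neg]
    refine inv_anti₀ (qf_pos (c n) ξ) ?_
    unfold qf
    have := Real.add_one_le_exp ((2 * π * ξ) ^ 2 * c n ^ 2)
    nlinarith
  calc Real.exp (-(4 / 3 * (2 * π * ξ) ^ 2 * c k ^ 2))
      ≤ Real.exp (-((2 * π * ξ) ^ 2 * ∑ n ∈ Finset.Ico k N, c n ^ 2)) := by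
        rw [Real.exp_le_exp, neg_le_neg_iff]
        have := hc.sum_sq_Ico_le k N
        nlinarith [sq_nonneg (2 * π * ξ)]
    _ = ∏ n ∈ Finset.Ico k N, Real.exp (-((2 * π * ξ) ^ 2 * c n ^ 2)) := by
        rw [← Real.exp_sum, Finset.mul_sum, Finset.sum_neg_distrib]
    _ ≤ tailFin c k N ξ :=
        Finset.prod_le_prod (fun n _ => (Real.exp_pos _).le) fun n _ => hfac n

/-- `0 < r_k(ξ)`. [cite: Hegde2021, §3.1 Lemma 10 (p. 6)] -/
theorem IsAdmissible.tail_pos (hc : IsAdmissible c) (k : ℕ) (ξ : ℝ) : 0 < tail c k ξ :=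
  lt_of_lt_of_le (Real.exp_pos _) (le_ciInf fun N => hc.exp_le_tailFin k N ξ)

/-- Peeling off the first factor in the limit: `r_k = q_{c_k}⁻¹ · r_{k+1}`. [cite: Hegde2021, §3.1 Lemma 10 (p. 6)] -/
theorem tail_succ (c : ℕ → ℝ) (k : ℕ) (ξ : ℝ) : tail c k ξ = (qf (c k) ξ)⁻¹ * tail c (k + 1) ξ := by
  have h1 := tendsto_tailFin c k ξ
  have h2 : Tendsto (fun N => (qf (c k) ξ)⁻¹ * tailFin c (k + 1) N ξ) atTop
      (𝓝 ((qf (c k) ξ)⁻¹ * tail c (k + 1) ξ)) := (tendsto_tailFin c (k + 1) ξ).const_mul _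
  refine tendsto_nhds_unique h1 (h2.congr' ?_)
  filter_upwards [eventually_gt_atTop k] with N hN
  rw [tailFin_succ c hN]

/-- `r_{k+1} = q_{c_k} · r_k`. [cite: Hegde2021, §3.1 Lemma 10 (p. 6)] -/
theorem tail_succ' (c : ℕ → ℝ) (k : ℕ) (ξ : ℝ) : tail c (k + 1) ξ = qf (c k) ξ * tail c k ξ := by
  rw [tail_succ c k ξ, ← mul_assoc, mul_inv_cancel₀ (qf_pos _ _).ne', one_mul]

/-- Measurability of `r_k`. [cite: Hegde2021, §3.1 Lemma 10 (p. 6)] -/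
theorem measurable_tail (c : ℕ → ℝ) (k : ℕ) : Measurable (tail c k) :=
  Measurable.iInf fun N => (continuous_tailFin c k N).measurable

/-- The polynomial decay of `r_k`: `r_k(ξ) ≤ (1 + (2π c_{k+m} ξ)²)^{-(m+1)}` (use the `m + 1` factors
`n = k, …, k + m`, each `≥ q_{c_{k+m}}`). [cite: Hegde2021, §3.1 Lemma 10 (p. 6)] -/
theorem IsAdmissible.tail_le_inv_pow (hc : IsAdmissible c) (k m : ℕ) (ξ : ℝ) :
    tail c k ξ ≤ ((qf (c (k + m)) ξ) ^ (m + 1))⁻¹ := by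
  refine (tail_le_tailFin c k (k + m + 1) ξ).trans ?_
  unfold tailFin
  have hcard : (Finset.Ico k (k + m + 1)).card = m + 1 := by rw [Nat.card_Ico]; omega
  calc ∏ n ∈ Finset.Ico k (k + m + 1), (qf (c n) ξ)⁻¹
      ≤ ∏ _n ∈ Finset.Ico k (k + m + 1), (qf (c (k + m)) ξ)⁻¹ := by
        refine Finset.prod_le_prod (fun n _ => (inv_pos.mpr (qf_pos _ _)).le) fun n hn => ?_
        rw [Finset.mem_Ico] at hn
        exact inv_anti₀ (qf_pos _ _) (qf_le_qf (hc.pos _).le (hc.antitone (by omega)) ξ)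
    _ = ((qf (c (k + m)) ξ) ^ (m + 1))⁻¹ := by
        rw [Finset.prod_const, hcard, inv_pow]

/-- Integrability of `|ξ|^m / (1 + (aξ)²)^{m+1}` for `a > 0` (comparison with `(1 + ξ²)⁻¹`).
[folklore] -/
private theorem integrable_abs_pow_div_qf {a : ℝ} (ha : 0 < a) (m : ℕ) :
    Integrable fun ξ : ℝ => |ξ| ^ m * ((qf a ξ) ^ (m + 1))⁻¹ := by
  set b : ℝ := min 1 (2 * π * a) with hb
  have hb0 : 0 < b := lt_min one_pos (by positivity)
  have hb1 : b ≤ 1 := min_le_left _ _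
  have hkey : ∀ ξ : ℝ, |ξ| ^ m * ((qf a ξ) ^ (m + 1))⁻¹ ≤ (b ^ (2 * (m + 1)))⁻¹ * (1 + ξ ^ 2)⁻¹ := by
    intro ξ
    have hq : b ^ 2 * (1 + ξ ^ 2) ≤ qf a ξ := by
      unfold qf
      have h1 : b ^ 2 ≤ 1 := by nlinarith
      have h2 : b ^ 2 * ξ ^ 2 ≤ (2 * π * a * ξ) ^ 2 := by
        rw [show (2 * π * a * ξ) ^ 2 = (2 * π * a) ^ 2 * ξ ^ 2 by ring]
        exact mul_le_mul_of_nonneg_right (pow_le_pow_left₀ hb0.le (min_le_right _ _) 2)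
          (sq_nonneg _)
      nlinarith
    have hξ : |ξ| ≤ 1 + ξ ^ 2 := by nlinarith [sq_nonneg (|ξ| - 1), sq_abs ξ, abs_nonneg ξ]
    have hξm : |ξ| ^ m ≤ (1 + ξ ^ 2) ^ m := pow_le_pow_left₀ (abs_nonneg _) hξ m
    have hpos : 0 < 1 + ξ ^ 2 := by positivity
    have hqm : (b ^ 2 * (1 + ξ ^ 2)) ^ (m + 1) ≤ (qf a ξ) ^ (m + 1) :=
      pow_le_pow_left₀ (by positivity) hq _
    calc |ξ| ^ m * ((qf a ξ) ^ (m + 1))⁻¹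
        ≤ (1 + ξ ^ 2) ^ m * ((b ^ 2 * (1 + ξ ^ 2)) ^ (m + 1))⁻¹ :=
          mul_le_mul hξm (inv_anti₀ (by positivity) hqm)
            (inv_nonneg.mpr (pow_pos (qf_pos a ξ) _).le) (by positivity)
      _ = (b ^ (2 * (m + 1)))⁻¹ * (1 + ξ ^ 2)⁻¹ := by
          rw [mul_pow, ← pow_mul, pow_succ]
          field_simp
          ring
  refine Integrable.mono' (integrable_inv_one_add_sq.const_mul ((b ^ (2 * (m + 1)))⁻¹)) ?_
    (Eventually.of_forall fun ξ => ?_)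
  · refine (Measurable.mul (by fun_prop) ?_).aestronglyMeasurable
    exact ((continuous_qf a).pow _).measurable.inv
  · rw [Real.norm_eq_abs, abs_of_nonneg (mul_nonneg (by positivity)
      (inv_nonneg.mpr (pow_pos (qf_pos a ξ) _).le))]
    exact hkey ξ

/-- Integrability of `|ξ|^m r_k(ξ)` for every `m` (the multiplier has all moments).
[cite: Hegde2021, §3.1 Lemma 10 (p. 6)] -/
theorem IsAdmissible.integrable_abs_pow_mul_tail (hc : IsAdmissible c) (k m : ℕ) :
    Integrable fun ξ : ℝ => |ξ| ^ m * tail c k ξ := by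
  refine (integrable_abs_pow_div_qf (by have := hc.pos (k + m); positivity) m).mono' ?_
    (Eventually.of_forall fun ξ => ?_)
  · exact ((by fun_prop : Measurable fun ξ : ℝ => |ξ| ^ m).mul (measurable_tail c k)).aestronglyMeasurable
  · rw [Real.norm_eq_abs, abs_of_nonneg (mul_nonneg (by positivity) (tail_nonneg _ _ _))]
    exact mul_le_mul_of_nonneg_left (hc.tail_le_inv_pow k m ξ) (by positivity)

end Multiplier

/-! ## The kernels `ψ_k = 𝓕 r_k` -/

section Psi

variable {c : ℕ → ℝ}

/-- The multiplier as a complex-valued function. [cite: Hegde2021, §3.1 Lemma 10 (p. 6)] -/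
def tailC (c : ℕ → ℝ) (k : ℕ) (ξ : ℝ) : ℂ := (tail c k ξ : ℂ)

/-- `‖r_k(ξ)‖ = r_k(ξ)`. [cite: Hegde2021, §3.1 Lemma 10 (p. 6)] -/
theorem norm_tailC (c : ℕ → ℝ) (k : ℕ) (ξ : ℝ) : ‖tailC c k ξ‖ = tail c k ξ := by
  rw [tailC, Complex.norm_real, Real.norm_eq_abs, abs_of_nonneg (tail_nonneg c k ξ)]

/-- Measurability of the complex multiplier. [cite: Hegde2021, §3.1 Lemma 10 (p. 6)] -/
theorem measurable_tailC (c : ℕ → ℝ) (k : ℕ) : Measurable (tailC c k) :=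
  Complex.measurable_ofReal.comp (measurable_tail c k)

/-- The kernel `ψ_k := 𝓕 r_k` — for `k = 0` the Dixmier–Malliavin function `ψ` with
`ψ̂ = 1/∏ₙ(1 + (2π cₙ ξ)²)`, for `k ≥ 1` its "tails" (the convolution of the Laplace kernels
`p_{cₙ}`, `n ≥ k`). [cite: Hegde2021, §3.1 Lemma 10 (p. 6)] -/
def psi (c : ℕ → ℝ) (k : ℕ) : ℝ → ℂ := 𝓕 (tailC c k)

/-- Integrability of `ξⁿ • r_k(ξ)` (all moments). [cite: Hegde2021, §3.1 Lemma 10 (p. 6)] -/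
theorem IsAdmissible.integrable_pow_smul_tailC (hc : IsAdmissible c) (k n : ℕ) :
    Integrable fun ξ : ℝ => ξ ^ n • tailC c k ξ := by
  refine (hc.integrable_abs_pow_mul_tail k n).mono' ?_ (Eventually.of_forall fun ξ => ?_)
  · exact ((by fun_prop : Measurable fun ξ : ℝ => ξ ^ n).smul (measurable_tailC c k)).aestronglyMeasurable
  · rw [norm_smul, norm_pow, Real.norm_eq_abs, norm_tailC]

/-- Integrability of `‖ξ‖ⁿ ‖r_k(ξ)‖` (the hypothesis of `Real.contDiff_fourier`). [cite: Hegde2021, §3.1 Lemma 10 (p. 6)] -/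
theorem IsAdmissible.integrable_norm_pow_mul_norm_tailC (hc : IsAdmissible c) (k n : ℕ) :
    Integrable fun ξ : ℝ => ‖ξ‖ ^ n * ‖tailC c k ξ‖ := by
  have : (fun ξ : ℝ => ‖ξ‖ ^ n * ‖tailC c k ξ‖) = fun ξ : ℝ => |ξ| ^ n * tail c k ξ := by
    funext ξ; rw [Real.norm_eq_abs, norm_tailC]
  rw [this]
  exact hc.integrable_abs_pow_mul_tail k n

/-- `r_k ∈ L¹`. [cite: Hegde2021, §3.1 Lemma 10 (p. 6)] -/
theorem IsAdmissible.integrable_tailC (hc : IsAdmissible c) (k : ℕ) : Integrable (tailC c k) := by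
  simpa using hc.integrable_pow_smul_tailC k 0

/-- `ψ_k` is smooth. [cite: Hegde2021, §3.1 Lemma 10 (p. 6)] -/
theorem IsAdmissible.contDiff_psi (hc : IsAdmissible c) (k : ℕ) : ContDiff ℝ ∞ (psi c k) :=
  Real.contDiff_fourier fun n _ => hc.integrable_norm_pow_mul_norm_tailC k n

/-- The derivatives of `ψ_k`: `ψ_k^{(n)} = 𝓕((−2πiξ)ⁿ r_k)`. [cite: Hegde2021, §3.1 Lemma 10 (p. 6)] -/
theorem IsAdmissible.iteratedDeriv_psi (hc : IsAdmissible c) (k n : ℕ) :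
    iteratedDeriv n (psi c k) = 𝓕 (fun ξ : ℝ => (-2 * π * I * ξ) ^ n • tailC c k ξ) :=
  Real.iteratedDeriv_fourier (N := (⊤ : ℕ∞)) (fun m _ => hc.integrable_pow_smul_tailC k m) le_top

/-- Uniform bounds on the derivatives: `‖ψ_k^{(n)}(x)‖ ≤ (2π)ⁿ ∫ |ξ|ⁿ r_k(ξ) dξ`.
[cite: Hegde2021, §3.1 Lemma 10 (p. 6)] -/
theorem IsAdmissible.norm_iteratedDeriv_psi_le (hc : IsAdmissible c) (k n : ℕ) (x : ℝ) :
    ‖iteratedDeriv n (psi c k) x‖ ≤ (2 * π) ^ n * ∫ ξ : ℝ, |ξ| ^ n * tail c k ξ := by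
  rw [hc.iteratedDeriv_psi k n]
  refine (VectorFourier.norm_fourierIntegral_le_integral_norm _ _ _ _ _).trans (le_of_eq ?_)
  rw [← integral_const_mul]
  congr 1
  funext ξ
  rw [norm_smul, norm_pow, norm_tailC]
  have : ‖(-2 * π * I * ξ : ℂ)‖ = 2 * π * |ξ| := by
    rw [show (-2 * π * I * ξ : ℂ) = ((-(2 * π * ξ) : ℝ) : ℂ) * I by push_cast; ring]
    rw [norm_mul, Complex.norm_I, mul_one, Complex.norm_real, Real.norm_eq_abs, abs_neg, abs_mul,
      abs_of_pos (by positivity : (0 : ℝ) < 2 * π)]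
  rw [this, mul_pow, mul_assoc]

/-- Integrability of the Fourier integrand (plumbing). [cite: Hegde2021, §3.1 Lemma 10 (p. 6)] -/
theorem IsAdmissible.integrable_fourierChar_smul_tailC (hc : IsAdmissible c) (k : ℕ) (w : ℝ) :
    Integrable fun v : ℝ => 𝐞 (-(v * w)) • tailC c k v := by
  have h := (Real.fourierIntegral_convergent_iff (μ := volume) (f := tailC c k) w).2
    (hc.integrable_tailC k)
  simpa [mul_comm w] using h

end Psi

section Identities

variable {c : ℕ → ℝ}

/-- Integrability of the weighted Fourier integrands `e^{−2πivw} (g(v) r_k(v))` for `|g(v)| ≤ C|v|ᵐ`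
(plumbing for the linearity computations). [cite: Hegde2021, §3.1 Lemma 10 (p. 6)] -/
theorem IsAdmissible.integrable_cexp_smul_mul_tailC (hc : IsAdmissible c) (k m : ℕ) (w C : ℝ)
    {g : ℝ → ℂ} (hg : Measurable g) (hbound : ∀ v, ‖g v‖ ≤ C * |v| ^ m) :
    Integrable fun v : ℝ => cexp (↑(-2 * π * v * w) * I) • (g v * tailC c k v) := by
  refine ((hc.integrable_abs_pow_mul_tail k m).const_mul C).mono' ?_
    (Eventually.of_forall fun v => ?_)
  · exact ((by fun_prop : Measurable fun v : ℝ => cexp (↑(-2 * π * v * w) * I)).smul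
      (hg.mul (measurable_tailC c k))).aestronglyMeasurable
  · rw [norm_smul, Complex.norm_exp_ofReal_mul_I, one_mul, norm_mul, norm_tailC]
    calc ‖g v‖ * tail c k v ≤ C * |v| ^ m * tail c k v :=
          mul_le_mul_of_nonneg_right (hbound v) (tail_nonneg _ _ _)
      _ = C * (|v| ^ m * tail c k v) := by ring

/-- **The recursion** `ψ_k − ψ_{k+1} = c_k² ψ_k''` — the Fourier-side form of the Green's function
identity `p_c'' = (p_c − δ)/c²` for the Laplace kernel `p_c = (2c)⁻¹e^{−|x|/c}`, i.e. of
`ψ_k = p_{c_k} ∗ ψ_{k+1}`; no convolution theorem is needed: `r_{k+1} − r_k = (2π c_k ξ)² r_k`.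
[cite: Hegde2021, §3.1 Lemma 10 (p. 6)] -/
theorem IsAdmissible.psi_sub_psi_succ (hc : IsAdmissible c) (k : ℕ) (x : ℝ) :
    psi c k x - psi c (k + 1) x = (c k : ℂ) ^ 2 * iteratedDeriv 2 (psi c k) x := by
  rw [hc.iteratedDeriv_psi k 2]
  simp only [psi, Real.fourier_real_eq_integral_exp_smul]
  have h1 : Integrable fun v : ℝ => cexp (↑(-2 * π * v * x) * I) • tailC c k v := by
    simpa using hc.integrable_cexp_smul_mul_tailC k 0 x 1 (g := fun _ => (1 : ℂ)) measurable_const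
      (fun v => by simp)
  have h2 : Integrable fun v : ℝ => cexp (↑(-2 * π * v * x) * I) • tailC c (k + 1) v := by
    simpa using hc.integrable_cexp_smul_mul_tailC (k + 1) 0 x 1 (g := fun _ => (1 : ℂ))
      measurable_const (fun v => by simp)
  rw [← integral_sub h1 h2, ← integral_const_mul]
  refine integral_congr_ae (Eventually.of_forall fun v => ?_)
  have ht : tailC c (k + 1) v = ((qf (c k) v : ℝ) : ℂ) * tailC c k v := by
    simp only [tailC, tail_succ' c k v]; push_cast; ring
  dsimp only
  rw [ht]
  simp only [smul_eq_mul, qf]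
  push_cast
  linear_combination (-4 * ↑π ^ 2 * (↑(c k) : ℂ) ^ 2 * (↑v : ℂ) ^ 2 *
    cexp (-2 * ↑π * ↑v * ↑x * I) * tailC c k v) * I_sq

/-! ### The generating function `Σ_j b_j (2πξ)^{2j} = 1/r₀(ξ)` and the truncated kernels -/

/-- The partial products in closed form: `r_{0,N}(ξ) = (∏_{n<N} (1 + (2πξ)² cₙ²))⁻¹`.
[cite: Hegde2021, §3.1 Lemma 10 (p. 6)] -/
theorem tailFin_zero_eq (c : ℕ → ℝ) (N : ℕ) (ξ : ℝ) :
    tailFin c 0 N ξ = (∏ n ∈ Finset.range N, (1 + (2 * π * ξ) ^ 2 * c n ^ 2))⁻¹ := by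
  unfold tailFin
  rw [Finset.range_eq_Ico, ← Finset.prod_inv_distrib]
  refine Finset.prod_congr rfl fun n _ => ?_
  unfold qf; ring_nf

/-- **Generating identity**: `Σ_j b_j ((2πξ)²)ʲ = 1/r₀(ξ)` (`HasSum`; sandwich between the partial
products `∏_{n<N}` and the full product). [cite: Hegde2021, §3.1 Lemma 10 (p. 6)] -/
theorem IsAdmissible.hasSum_coeff_mul_pow (hc : IsAdmissible c) (ξ : ℝ) :
    HasSum (fun j => coeff c j * ((2 * π * ξ) ^ 2) ^ j) (tail c 0 ξ)⁻¹ := by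
  set u : ℝ := (2 * π * ξ) ^ 2 with hu
  have hu0 : 0 ≤ u := sq_nonneg _
  set L : ℝ := (tail c 0 ξ)⁻¹ with hL
  have hprod : ∀ N, ∏ n ∈ Finset.range N, (1 + u * c n ^ 2) = (tailFin c 0 N ξ)⁻¹ := by
    intro N; rw [tailFin_zero_eq, inv_inv]
  have hlim : Tendsto (fun N => ∏ n ∈ Finset.range N, (1 + u * c n ^ 2)) atTop (𝓝 L) := by
    simp_rw [hprod]
    exact (tendsto_tailFin c 0 ξ).inv₀ (hc.tail_pos 0 ξ).ne'
  have hS_le : ∀ J, ∑ j ∈ Finset.range J, coeff c j * u ^ j ≤ L := by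
    intro J
    have h1 : Tendsto (fun N => ∑ j ∈ Finset.range J, esq c N j * u ^ j) atTop
        (𝓝 (∑ j ∈ Finset.range J, coeff c j * u ^ j)) :=
      tendsto_finsetSum _ fun j _ => (hc.tendsto_esq j).mul_const _
    refine le_of_tendsto h1 (eventually_atTop.2 ⟨J, fun N hN => ?_⟩)
    calc ∑ j ∈ Finset.range J, esq c N j * u ^ j
        ≤ ∑ j ∈ Finset.range (N + 1), esq c N j * u ^ j :=
          Finset.sum_le_sum_of_subset_of_nonneg (Finset.range_mono (by omega))
            fun j _ _ => mul_nonneg (esq_nonneg c N j) (pow_nonneg hu0 j)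
      _ = ∏ n ∈ Finset.range N, (1 + u * c n ^ 2) := (prod_one_add_mul_sq c u N).symm
      _ = (tailFin c 0 N ξ)⁻¹ := hprod N
      _ ≤ L := inv_anti₀ (hc.tail_pos 0 ξ) (tail_le_tailFin c 0 N ξ)
  have hP_le : ∀ N, ∏ n ∈ Finset.range N, (1 + u * c n ^ 2) ≤
      ∑ j ∈ Finset.range (N + 1), coeff c j * u ^ j := by
    intro N
    rw [prod_one_add_mul_sq]
    exact Finset.sum_le_sum fun j _ =>
      mul_le_mul_of_nonneg_right (hc.esq_le_coeff N j) (pow_nonneg hu0 _)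
  rw [hasSum_iff_tendsto_nat_of_nonneg (fun j => mul_nonneg (hc.coeff_nonneg j) (pow_nonneg hu0 j))]
  refine tendsto_of_tendsto_of_tendsto_of_le_of_le' (hlim.comp (tendsto_sub_atTop_nat 1))
    tendsto_const_nhds ?_ (Eventually.of_forall hS_le)
  filter_upwards [eventually_ge_atTop 1] with J hJ
  have := hP_le (J - 1)
  rwa [Nat.sub_add_cancel hJ] at this

/-- The truncations `s_n(ξ) = Σ_{j<n} b_j (2πξ)^{2j}` of the entire function `P = 1/r₀`.
[cite: Hegde2021, §3.1 Lemma 10 (p. 6)] -/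
def sfin (c : ℕ → ℝ) (n : ℕ) (ξ : ℝ) : ℝ := ∑ j ∈ Finset.range n, coeff c j * ((2 * π * ξ) ^ 2) ^ j

/-- `0 ≤ s_n`. [cite: Hegde2021, §3.1 Lemma 10 (p. 6)] -/
theorem IsAdmissible.sfin_nonneg (hc : IsAdmissible c) (n : ℕ) (ξ : ℝ) : 0 ≤ sfin c n ξ :=
  Finset.sum_nonneg fun j _ => mul_nonneg (hc.coeff_nonneg j) (pow_nonneg (sq_nonneg _) j)

/-- `s_n r₀ ≤ 1` (the truncated multiplier is a contraction). [cite: Hegde2021, §3.1 Lemma 10 (p. 6)] -/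
theorem IsAdmissible.sfin_mul_tail_le_one (hc : IsAdmissible c) (n : ℕ) (ξ : ℝ) :
    sfin c n ξ * tail c 0 ξ ≤ 1 := by
  have h1 : sfin c n ξ ≤ (tail c 0 ξ)⁻¹ :=
    sum_le_hasSum (Finset.range n) (fun j _ => mul_nonneg (hc.coeff_nonneg j) (pow_nonneg (sq_nonneg _) j))
      (hc.hasSum_coeff_mul_pow ξ)
  have h2 := hc.tail_pos 0 ξ
  calc sfin c n ξ * tail c 0 ξ ≤ (tail c 0 ξ)⁻¹ * tail c 0 ξ :=
        mul_le_mul_of_nonneg_right h1 h2.le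
    _ = 1 := inv_mul_cancel₀ h2.ne'

/-- `s_n(ξ) r₀(ξ) → 1` (the truncated multipliers exhaust the identity). [cite: Hegde2021, §3.1 Lemma 10 (p. 6)] -/
theorem IsAdmissible.tendsto_sfin_mul_tail (hc : IsAdmissible c) (ξ : ℝ) :
    Tendsto (fun n => sfin c n ξ * tail c 0 ξ) atTop (𝓝 1) := by
  have h := ((hc.hasSum_coeff_mul_pow ξ).tendsto_sum_nat).mul_const (tail c 0 ξ)
  rwa [inv_mul_cancel₀ (hc.tail_pos 0 ξ).ne'] at h

/-- Continuity of `s_n`. [cite: Hegde2021, §3.1 Lemma 10 (p. 6)] -/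
theorem continuous_sfin (c : ℕ → ℝ) (n : ℕ) : Continuous (sfin c n) := by
  unfold sfin; fun_prop

/-- `((2πv)²)ʲ = (2π)^{2j} |v|^{2j}` (plumbing). [folklore] -/
private theorem sq_pow_eq (v : ℝ) (j : ℕ) : ((2 * π * v) ^ 2) ^ j = (2 * π) ^ (2 * j) * |v| ^ (2 * j) := by
  rw [show (2 * π * v) ^ 2 = (2 * π) ^ 2 * |v| ^ 2 by rw [sq_abs]; ring, mul_pow, ← pow_mul, ← pow_mul]

/-- `s_n(ξ) ≤ C_n (1 + |ξ|^{2n})`-type polynomial bound: `|s_n(ξ)| ≤ (Σ_{j<n} b_j (2π)^{2j}) (1 + |ξ|)^{2n}`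
is not needed; we only use `0 ≤ s_n ≤ Σ_j b_j ((2π)² (1+ξ²))ʲ`-free bound `s_n(ξ) ≤ s_n(1) (1 + |ξ|)^{2n}`…
Instead we record the crude monomial bound used for integrability: `s_n(ξ) ≤ A_n * (1 + |ξ| ^ (2n))`.
[cite: Hegde2021, §3.1 Lemma 10 (p. 6)] -/
theorem IsAdmissible.sfin_le (hc : IsAdmissible c) (n : ℕ) (ξ : ℝ) :
    sfin c n ξ ≤ (∑ j ∈ Finset.range n, coeff c j * (2 * π) ^ (2 * j)) * (1 + |ξ| ^ (2 * n)) := by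
  unfold sfin
  rw [Finset.sum_mul]
  refine Finset.sum_le_sum fun j hj => ?_
  rw [Finset.mem_range] at hj
  have hb := hc.coeff_nonneg j
  rw [sq_pow_eq ξ j, ← mul_assoc]
  refine mul_le_mul_of_nonneg_left ?_ (by positivity)
  have h1 : |ξ| ^ (2 * j) ≤ 1 + |ξ| ^ (2 * n) := by
    rcases le_or_gt |ξ| 1 with h | h
    · calc |ξ| ^ (2 * j) ≤ 1 := pow_le_one₀ (abs_nonneg _) h
        _ ≤ 1 + |ξ| ^ (2 * n) := le_add_of_nonneg_right (by positivity)
    · calc |ξ| ^ (2 * j) ≤ |ξ| ^ (2 * n) := pow_le_pow_right₀ h.le (by omega)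
        _ ≤ 1 + |ξ| ^ (2 * n) := le_add_of_nonneg_left (by norm_num)
  exact h1

/-- **The truncated Dixmier–Malliavin kernels are Fourier transforms of contractions**:
`Σ_{j<n} (−1)ʲ b_j ψ₀^{(2j)} = 𝓕(s_n r₀)`. [cite: Hegde2021, §3.1 Lemma 10 (p. 6)] -/
theorem IsAdmissible.kernel_eq_fourier (hc : IsAdmissible c) (n : ℕ) (y : ℝ) :
    ∑ j ∈ Finset.range n, (-1 : ℂ) ^ j * coeff c j * iteratedDeriv (2 * j) (psi c 0) y =
      𝓕 (fun ξ : ℝ => ((sfin c n ξ * tail c 0 ξ : ℝ) : ℂ)) y := by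
  have hterm : ∀ j, (-1 : ℂ) ^ j * coeff c j * iteratedDeriv (2 * j) (psi c 0) y =
      ∫ v : ℝ, cexp (↑(-2 * π * v * y) * I) •
        (((coeff c j * ((2 * π * v) ^ 2) ^ j : ℝ) : ℂ) * tailC c 0 v) := by
    intro j
    rw [hc.iteratedDeriv_psi 0 (2 * j), Real.fourier_real_eq_integral_exp_smul, ← integral_const_mul]
    refine integral_congr_ae (Eventually.of_forall fun v => ?_)
    have hpow : (-2 * π * I * v : ℂ) ^ (2 * j) = (-1) ^ j * ((((2 * π * v) ^ 2) ^ j : ℝ) : ℂ) := by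
      rw [pow_mul]
      have h2 : (-2 * π * I * v : ℂ) ^ 2 = -((((2 * π * v) ^ 2 : ℝ)) : ℂ) := by
        push_cast
        linear_combination (4 * ↑π ^ 2 * (↑v : ℂ) ^ 2) * I_sq
      rw [h2, neg_pow]
      push_cast
      ring
    have hsq : ((-1 : ℂ) ^ j) * (-1) ^ j = 1 := by
      rw [← mul_pow]; norm_num
    dsimp only
    rw [hpow]
    simp only [smul_eq_mul]
    push_cast
    linear_combination ((coeff c j : ℂ) * cexp (-2 * ↑π * ↑v * ↑y * I) *
      (((2 * π * v) ^ 2) ^ j : ℂ) * tailC c 0 v) * hsq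
  have hint : ∀ j ∈ Finset.range n, Integrable fun v : ℝ => cexp (↑(-2 * π * v * y) * I) •
      (((coeff c j * ((2 * π * v) ^ 2) ^ j : ℝ) : ℂ) * tailC c 0 v) := by
    intro j _
    refine hc.integrable_cexp_smul_mul_tailC 0 (2 * j) y (coeff c j * (2 * π) ^ (2 * j))
      (Complex.measurable_ofReal.comp (by fun_prop)) fun v => ?_
    rw [Complex.norm_real, Real.norm_eq_abs, abs_of_nonneg (mul_nonneg (hc.coeff_nonneg j)
      (pow_nonneg (sq_nonneg _) j)), sq_pow_eq v j, mul_assoc]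
  rw [Finset.sum_congr rfl fun j _ => hterm j, ← integral_finsetSum _ hint,
    Real.fourier_real_eq_integral_exp_smul]
  refine integral_congr_ae (Eventually.of_forall fun v => ?_)
  simp only [sfin, tailC, smul_eq_mul]
  push_cast
  rw [Finset.sum_mul, Finset.mul_sum]

end Identities

/-! ### The truncated kernels form an approximate identity (tested on test functions) -/

section Pairing

variable {c : ℕ → ℝ}

/-- Test functions have compactly supported iterated derivatives (plumbing). [folklore] -/
private theorem hasCompactSupport_iteratedDeriv {σ : ℝ → ℂ} (hσc : HasCompactSupport σ) (n : ℕ) :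
    HasCompactSupport (iteratedDeriv n σ) := by
  refine (hσc.iteratedFDeriv (𝕜 := ℝ) n).mono (Function.support_subset_iff'.2 fun x hx => ?_)
  simp [iteratedDeriv_eq_iteratedFDeriv, Function.notMem_support.1 hx]

/-- The Fourier transform of a test function is integrable (two integrations by parts:
`(1 + w²) |𝓕σ(w)| ≤ ‖σ‖₁ + ‖σ''‖₁/(4π²)`). [folklore] -/
private theorem integrable_fourier_of_contDiff {σ : ℝ → ℂ} (hσ : ContDiff ℝ ∞ σ) (hσc : HasCompactSupport σ) :
    Integrable (𝓕 σ) := by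
  have hσi : Integrable σ := hσ.continuous.integrable_of_hasCompactSupport hσc
  have hσ2 : ContDiff ℝ ((2 : ℕ) : ℕ∞) σ := hσ.of_le (by exact_mod_cast le_top)
  have hder : ∀ n : ℕ, (n : ℕ∞) ≤ ((2 : ℕ) : ℕ∞) → Integrable (iteratedDeriv n σ) := fun n _ =>
    (hσ.continuous_iteratedDeriv n (by exact_mod_cast le_top)).integrable_of_hasCompactSupport
      (hasCompactSupport_iteratedDeriv hσc n)
  have hF2 := Real.fourier_iteratedDeriv (n := 2) hσ2 hder le_rfl
  set A : ℝ := ∫ v, ‖σ v‖ with hA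
  set B : ℝ := ∫ v, ‖iteratedDeriv 2 σ v‖ with hB
  have hbound : ∀ w : ℝ, ‖𝓕 σ w‖ ≤ (A + B) * (1 + w ^ 2)⁻¹ := by
    intro w
    have h1 : ‖𝓕 σ w‖ ≤ A := VectorFourier.norm_fourierIntegral_le_integral_norm _ _ _ _ _
    have h2 : ‖𝓕 (iteratedDeriv 2 σ) w‖ ≤ B :=
      VectorFourier.norm_fourierIntegral_le_integral_norm _ _ _ _ _
    rw [hF2] at h2
    dsimp only at h2
    rw [norm_smul, norm_pow] at h2
    have h3 : ‖(2 * π * I * w : ℂ)‖ = 2 * π * |w| := by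
      rw [show (2 * π * I * w : ℂ) = (((2 * π * w) : ℝ) : ℂ) * I by push_cast; ring, norm_mul,
        Complex.norm_I, mul_one, Complex.norm_real, Real.norm_eq_abs, abs_mul,
        abs_of_pos (by positivity : (0 : ℝ) < 2 * π)]
    rw [h3] at h2
    have h4 : w ^ 2 * ‖𝓕 σ w‖ ≤ B := by
      have : w ^ 2 ≤ (2 * π * |w|) ^ 2 := by
        rw [mul_pow, sq_abs]
        have : (1 : ℝ) ≤ (2 * π) ^ 2 := by nlinarith [Real.two_le_pi]
        nlinarith [sq_nonneg w]
      exact (mul_le_mul_of_nonneg_right this (norm_nonneg _)).trans h2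
    have hpos : 0 < 1 + w ^ 2 := by positivity
    rw [← div_eq_mul_inv, le_div_iff₀ hpos]
    nlinarith [norm_nonneg (𝓕 σ w)]
  refine Integrable.mono' (integrable_inv_one_add_sq.const_mul (A + B)) ?_ (Eventually.of_forall hbound)
  exact (VectorFourier.fourierIntegral_continuous Real.continuous_fourierChar continuous_inner
    hσi).aestronglyMeasurable

/-- Integrability of the truncated multipliers `s_n r₀` (polynomial times a multiplier with all
moments). [cite: Hegde2021, §3.1 Lemma 10 (p. 6)] -/
theorem IsAdmissible.integrable_sfin_mul_tail (hc : IsAdmissible c) (n : ℕ) :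
    Integrable fun ξ : ℝ => ((sfin c n ξ * tail c 0 ξ : ℝ) : ℂ) := by
  set A : ℝ := ∑ j ∈ Finset.range n, coeff c j * (2 * π) ^ (2 * j) with hA
  have hA0 : 0 ≤ A := Finset.sum_nonneg fun j _ => mul_nonneg (hc.coeff_nonneg j) (by positivity)
  have hint : Integrable fun ξ : ℝ => A * (|ξ| ^ 0 * tail c 0 ξ) + A * (|ξ| ^ (2 * n) * tail c 0 ξ) :=
    ((hc.integrable_abs_pow_mul_tail 0 0).const_mul A).add
      ((hc.integrable_abs_pow_mul_tail 0 (2 * n)).const_mul A)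
  refine hint.mono' ?_ (Eventually.of_forall fun ξ => ?_)
  · exact (Complex.measurable_ofReal.comp ((continuous_sfin c n).measurable.mul
      (measurable_tail c 0))).aestronglyMeasurable
  · rw [Complex.norm_real, Real.norm_eq_abs, abs_of_nonneg (mul_nonneg (hc.sfin_nonneg n ξ)
      (tail_nonneg c 0 ξ))]
    have h := hc.sfin_le n ξ
    have ht := tail_nonneg c 0 ξ
    calc sfin c n ξ * tail c 0 ξ ≤ A * (1 + |ξ| ^ (2 * n)) * tail c 0 ξ :=
          mul_le_mul_of_nonneg_right h ht
      _ = A * (|ξ| ^ 0 * tail c 0 ξ) + A * (|ξ| ^ (2 * n) * tail c 0 ξ) := by ring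

/-- **Approximate identity** (Hegde 2021, Lemma 10: `Σ_{j≤n} (−1)ʲ b_j ψ^{(2j)} → δ` in `𝒮′`, here
tested on test functions): for every smooth compactly supported `σ`,
`∫ 𝓕(s_n r₀)(y) σ(y) dy → σ(0)` — by self-adjointness of `𝓕`, dominated convergence on the
multiplier side (`0 ≤ s_n r₀ ≤ 1 ↑ 1`) and Fourier inversion at `0`.
[cite: Hegde2021, §3.1 Lemma 10 (p. 6)] -/
theorem IsAdmissible.tendsto_integral_fourier_sfin_mul (hc : IsAdmissible c) {σ : ℝ → ℂ}
    (hσ : ContDiff ℝ ∞ σ) (hσc : HasCompactSupport σ) :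
    Tendsto (fun n => ∫ y : ℝ, 𝓕 (fun ξ : ℝ => ((sfin c n ξ * tail c 0 ξ : ℝ) : ℂ)) y * σ y) atTop
      (𝓝 (σ 0)) := by
  have hσi : Integrable σ := hσ.continuous.integrable_of_hasCompactSupport hσc
  have hFσ : Integrable (𝓕 σ) := integrable_fourier_of_contDiff hσ hσc
  have hflip : ∀ n, ∫ y : ℝ, 𝓕 (fun ξ : ℝ => ((sfin c n ξ * tail c 0 ξ : ℝ) : ℂ)) y * σ y =
      ∫ ξ : ℝ, ((sfin c n ξ * tail c 0 ξ : ℝ) : ℂ) * 𝓕 σ ξ := by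
    intro n
    have h := VectorFourier.integral_fourierIntegral_smul_eq_flip (L := innerₗ ℝ) (μ := volume)
      (ν := volume) Real.continuous_fourierChar continuous_inner (hc.integrable_sfin_mul_tail n) hσi
    simp only [flip_innerₗ, smul_eq_mul] at h
    exact h
  have hlim : Tendsto (fun n => ∫ ξ : ℝ, ((sfin c n ξ * tail c 0 ξ : ℝ) : ℂ) * 𝓕 σ ξ) atTop
      (𝓝 (∫ ξ : ℝ, 𝓕 σ ξ)) := by
    refine tendsto_integral_of_dominated_convergence (fun ξ => ‖𝓕 σ ξ‖) (fun n => ?_) hFσ.norm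
      (fun n => Eventually.of_forall fun ξ => ?_) (Eventually.of_forall fun ξ => ?_)
    · exact ((Complex.measurable_ofReal.comp ((continuous_sfin c n).measurable.mul
        (measurable_tail c 0))).mul (VectorFourier.fourierIntegral_continuous
          Real.continuous_fourierChar continuous_inner hσi).measurable).aestronglyMeasurable
    · rw [norm_mul, Complex.norm_real, Real.norm_eq_abs, abs_of_nonneg (mul_nonneg
        (hc.sfin_nonneg n ξ) (tail_nonneg c 0 ξ))]
      exact mul_le_of_le_one_left (norm_nonneg _) (hc.sfin_mul_tail_le_one n ξ)
    · have h := ((Complex.continuous_ofReal.tendsto 1).comp (hc.tendsto_sfin_mul_tail ξ)).mul_const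
        (𝓕 σ ξ)
      simpa using h
  have hinv : ∫ ξ : ℝ, 𝓕 σ ξ = σ 0 := by
    have h := congrFun (Continuous.fourierInv_fourier_eq hσ.continuous hσi hFσ) 0
    rw [Real.fourierInv_eq] at h
    simpa using h
  simp_rw [hflip]
  rw [← hinv]
  exact hlim

end Pairing

end DixmierMalliavin

end Literature.Analysis.Convolution
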